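import Literature.NumberTheory.Sieve.BombieriVinogradovReduction
import Mathlib.NumberTheory.Chebyshev
import Mathlib.Algebra.BigOperators.Module
import HarnessLib

/-!
# Character sums over primes from `ψ(x, χ)`: the Siegel–Walfisz input of Nathanson's Thm 10.7

Topic `Literature/NumberTheory/Sieve`. Everything in this file is PROVED. It supplies the
"Siegel–Walfisz step" of the bilinear form inequality in the proof of Chen's theorem (Nathanson,
*Additive Number Theory: The Classical Bases*, GTM 164, Thm 10.7, p. 291 of the book: "We can
estimate the character sum `∑_{p < Y} χ(p)` by means of the Siegel–Walfisz theorem …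
`∑_{p<Y} χ(p) ≪ rY/(log Y)^B`"), in the form that the tree's Siegel–Walfisz theorem
(`Literature.NumberTheory.Sieve.siegel_walfisz`, for `ψ(x; q, a)`, PROVED as
`Literature.NumberTheory.LFunctions.siegel_walfisz_holds`) delivers. The book argues with
`π(Y; r, a) = π(Y)/φ(r) + O(Y/(log Y)^B)`; we pass from `ψ(·, χ)` to the primes instead:

* `PrimeCharSum.norm_sum_range_smul_le_of_antitone` — Abel's inequality: for an antitone weight
  `f ≥ 0` and partial sums `‖∑_{j<k} g(j)‖ ≤ M` (`k ≤ T`), `‖∑_{n<T} f(n) g(n)‖ ≤ f(0) M`;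
* `PrimeCharSum.norm_sum_primesBelow_le` — `‖∑_{p<T} χ(p)‖ ≤ M/log 2 + 2√T log T/log 2` whenever
  `‖ψ(k, χ)‖ ≤ M` for all `k < T` (Abel summation with the weight `1/log n` applied to
  `χ(n)Λ(n)`, and `ψ(T) − ϑ(T) ≤ 2√T log T` from Mathlib for the prime powers);
* `PrimeCharSum.chebyshevPsiCharSup_le_of_SW` — under the Siegel–Walfisz bound `SWBound A₂ C₂`
  (the tree's constant package), for `x ≥ 9`, `χ ≠ χ₀` mod `r`, `1 ≤ r ≤ (log x/2)^{A₂}`: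
  `max_{t ≤ x} ‖ψ(t, χ)‖ ≤ r (7√x + C₂ 2^{A₂} x/(log x)^{A₂})`;
* `PrimeCharSum.norm_sum_primesBelow_le_of_SW` — the combination: for `T ≤ x + 1`,
  `‖∑_{p<T} χ(p)‖ ≤ r (7√x + C₂ 2^{A₂} x/(log x)^{A₂})/log 2 + 2 √T log T/log 2`.

## References

* M. B. Nathanson, *Additive Number Theory: The Classical Bases*, GTM 164 (1996), proof of
  Thm 10.7 (p. 291). [Nathanson1996]
* H. Davenport, *Multiplicative Number Theory*, ch. 28. [DavenportMNT1980]
-/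

noncomputable section

open Finset Real
open scoped ArithmeticFunction.vonMangoldt

namespace Literature.NumberTheory.Sieve

namespace PrimeCharSum

/-! ### Abel's inequality for antitone weights -/

/-- **Abel's inequality**: if `f : ℕ → ℝ` is antitone and nonnegative and the partial sums of
`g : ℕ → ℂ` satisfy `‖∑_{j<k} g(j)‖ ≤ M` for all `k ≤ T`, then `‖∑_{n<T} f(n) g(n)‖ ≤ f(0) M`
(summation by parts, Mathlib's `Finset.sum_range_by_parts`, and telescoping). [folklore] -/
theorem norm_sum_range_smul_le_of_antitone {f : ℕ → ℝ} {g : ℕ → ℂ} (hf : Antitone f)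
    (hf0 : ∀ n, 0 ≤ f n) {T : ℕ} {M : ℝ}
    (hM : ∀ k, k ≤ T → ‖∑ j ∈ Finset.range k, g j‖ ≤ M) :
    ‖∑ n ∈ Finset.range T, f n • g n‖ ≤ f 0 * M := by
  have hM0 : 0 ≤ M := le_trans (norm_nonneg _) (hM 0 (Nat.zero_le _))
  rcases Nat.eq_zero_or_pos T with rfl | hT
  · simp only [Finset.range_zero, Finset.sum_empty, norm_zero]
    exact mul_nonneg (hf0 0) hM0
  rw [Finset.sum_range_by_parts]
  set G : ℕ → ℂ := fun k => ∑ j ∈ Finset.range k, g j with hG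
  have h1 : ‖f (T - 1) • G T‖ ≤ f (T - 1) * M := by
    rw [norm_smul, Real.norm_of_nonneg (hf0 _)]
    exact mul_le_mul_of_nonneg_left (hM T le_rfl) (hf0 _)
  have h2 : ‖∑ i ∈ Finset.range (T - 1), (f (i + 1) - f i) • G (i + 1)‖ ≤
      ∑ i ∈ Finset.range (T - 1), (f i - f (i + 1)) * M := by
    refine (norm_sum_le _ _).trans (Finset.sum_le_sum fun i hi => ?_)
    rw [norm_smul, Real.norm_eq_abs, abs_sub_comm, abs_of_nonneg (sub_nonneg.mpr (hf (Nat.le_succ i)))]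
    refine mul_le_mul_of_nonneg_left (hM (i + 1) ?_) (sub_nonneg.mpr (hf (Nat.le_succ i)))
    have := Finset.mem_range.mp hi
    omega
  have htel : ∑ i ∈ Finset.range (T - 1), (f i - f (i + 1)) * M = (f 0 - f (T - 1)) * M := by
    rw [← Finset.sum_mul, Finset.sum_range_sub']
  calc ‖f (T - 1) • G T - ∑ i ∈ Finset.range (T - 1), (f (i + 1) - f i) • G (i + 1)‖
      ≤ ‖f (T - 1) • G T‖ + ‖∑ i ∈ Finset.range (T - 1), (f (i + 1) - f i) • G (i + 1)‖ :=
        norm_sub_le _ _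
    _ ≤ f (T - 1) * M + (f 0 - f (T - 1)) * M := by rw [← htel]; exact add_le_add h1 h2
    _ = f 0 * M := by ring

/-! ### From `ψ(·, χ)` to the primes -/

variable {r : ℕ}

/-- The partial sums `∑_{j<k} χ(j)Λ(j)` are the values `ψ(k − 1, χ)` (and `0` for `k = 0`).
[folklore] -/
theorem sum_range_char_mul_vonMangoldt (χ : DirichletCharacter ℂ r) {k : ℕ} (hk : 1 ≤ k) :
    ∑ j ∈ Finset.range k, χ j * Λ j = chebyshevPsiChar χ ((k - 1 : ℕ) : ℝ) := by
  rw [chebyshevPsiChar, Nat.floor_natCast, Nat.sub_add_cancel hk]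

/-- **Character sums over primes from `ψ(·, χ)`** (the Siegel–Walfisz step of Nathanson's
Thm 10.7, p. 291, with `ψ` in place of `π`): if `‖ψ(k, χ)‖ ≤ M` for all integers `k < T`, then
`‖∑_{p < T} χ(p)‖ ≤ M/log 2 + 2√T log T/log 2`. Proof: `∑_{p<T} χ(p) = ∑_{n<T} w(n)χ(n)Λ(n) −
∑_{n<T, n not prime} w(n)χ(n)Λ(n)` with `w(n) = 1/log n`; the first sum is `≤ w(0) M` by Abel's
inequality, the second is at most `(ψ(T) − ϑ(T))/log 2 ≤ 2√T log T/log 2`.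
[cite: Nathanson1996, Thm 10.7 (proof, p. 291)] -/
theorem norm_sum_primesBelow_le (χ : DirichletCharacter ℂ r) {T : ℕ} {M : ℝ}
    (hM : ∀ k : ℕ, k < T → ‖chebyshevPsiChar χ k‖ ≤ M) (hM0 : 0 ≤ M) :
    ‖∑ p ∈ Nat.primesBelow T, χ p‖ ≤ M / Real.log 2 + 2 * Real.sqrt T * Real.log T / Real.log 2 := by
  have hlog2 : 0 < Real.log 2 := Real.log_pos one_lt_two
  -- the Abel weight `w(n) = 1/log(max(n, 2))` (`= 1/log n` for `n ≥ 2`), antitone on `ℕ`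
  set w : ℕ → ℝ := fun n => (Real.log (max (n : ℝ) 2))⁻¹ with hw
  have hw_anti : Antitone w := by
    intro m n hmn
    simp only [hw]
    have hm2 : (2 : ℝ) ≤ max (m : ℝ) 2 := le_max_right _ _
    refine inv_anti₀ (Real.log_pos (by linarith)) (Real.log_le_log (by linarith) ?_)
    exact max_le_max (by exact_mod_cast hmn) le_rfl
  have hw_pos : ∀ n, 0 < w n := fun n => by
    simp only [hw]
    have : (2 : ℝ) ≤ max (n : ℝ) 2 := le_max_right _ _
    exact inv_pos.mpr (Real.log_pos (by linarith))
  have hw0 : w 0 = (Real.log 2)⁻¹ := by simp [hw]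
  have hw_prime : ∀ {p : ℕ}, p.Prime → w p * Λ p = 1 := fun {p} hp => by
    have h2 : (2 : ℝ) ≤ p := by exact_mod_cast hp.two_le
    simp only [hw]
    rw [max_eq_left h2, ArithmeticFunction.vonMangoldt_apply_prime hp, inv_mul_cancel₀]
    exact (Real.log_pos (by linarith)).ne'
  have hw_le : ∀ n, w n * Λ n ≤ Λ n / Real.log 2 := fun n => by
    rw [div_eq_mul_inv, mul_comm (Λ n : ℝ), ← hw0]
    exact mul_le_mul_of_nonneg_right (hw_anti (Nat.zero_le n)) ArithmeticFunction.vonMangoldt_nonneg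
  -- the weighted sum over all `n < T`
  set g : ℕ → ℂ := fun n => χ n * Λ n with hg
  have hpartial : ∀ k, k ≤ T → ‖∑ j ∈ Finset.range k, g j‖ ≤ M := by
    intro k hk
    rcases Nat.eq_zero_or_pos k with rfl | hk1
    · simpa using hM0
    · rw [hg, sum_range_char_mul_vonMangoldt χ hk1]
      exact hM (k - 1) (by omega)
  have hAbel := norm_sum_range_smul_le_of_antitone hw_anti (fun n => (hw_pos n).le) hpartial
  rw [hw0] at hAbel
  -- split the weighted sum into primes and non-primes
  have hsplit : ∑ n ∈ Finset.range T, w n • g n =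
      ∑ p ∈ Nat.primesBelow T, χ p +
        ∑ n ∈ (Finset.range T).filter (fun n => ¬n.Prime), w n • g n := by
    rw [← Finset.sum_filter_add_sum_filter_not (Finset.range T) Nat.Prime]
    congr 1
    refine Finset.sum_congr rfl fun p hp => ?_
    have hp' : p.Prime := (Finset.mem_filter.mp hp).2
    rw [hg, Complex.real_smul]
    show (w p : ℂ) * (χ p * (Λ p : ℂ)) = χ p
    rw [show χ p * (Λ p : ℂ) = (Λ p : ℂ) * χ p by ring, ← mul_assoc,
      ← Complex.ofReal_mul, hw_prime hp', Complex.ofReal_one, one_mul]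
  -- the non-prime part
  have hnp : ‖∑ n ∈ (Finset.range T).filter (fun n => ¬n.Prime), w n • g n‖ ≤
      2 * Real.sqrt T * Real.log T / Real.log 2 := by
    have h1 : ‖∑ n ∈ (Finset.range T).filter (fun n => ¬n.Prime), w n • g n‖ ≤
        ∑ n ∈ (Finset.range T).filter (fun n => ¬n.Prime), Λ n / Real.log 2 := by
      refine (norm_sum_le _ _).trans (Finset.sum_le_sum fun n _ => ?_)
      rw [hg, norm_smul, norm_mul, Complex.norm_real, Real.norm_of_nonneg (hw_pos n).le,
        Real.norm_of_nonneg ArithmeticFunction.vonMangoldt_nonneg]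
      calc w n * (‖χ (n : ZMod r)‖ * Λ n) ≤ w n * (1 * Λ n) :=
            mul_le_mul_of_nonneg_left
              (mul_le_mul_of_nonneg_right (χ.norm_le_one _) ArithmeticFunction.vonMangoldt_nonneg)
              (hw_pos n).le
        _ = w n * Λ n := by ring
        _ ≤ Λ n / Real.log 2 := hw_le n
    refine h1.trans ?_
    rw [← Finset.sum_div]
    refine div_le_div_of_nonneg_right ?_ hlog2.le
    -- `∑_{n<T, not prime} Λ(n) ≤ ψ(T) - θ(T) ≤ 2√T log T`
    rcases Nat.eq_zero_or_pos T with rfl | hT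
    · simp
    have hT1 : (1 : ℝ) ≤ T := by exact_mod_cast hT
    have hsub : (Finset.range T).filter (fun n => ¬n.Prime) ⊆
        insert 0 ((Finset.Ioc 0 ⌊(T : ℝ)⌋₊).filter (fun n => ¬n.Prime)) := by
      intro n hn
      rw [Finset.mem_filter, Finset.mem_range] at hn
      rw [Finset.mem_insert, Finset.mem_filter, Finset.mem_Ioc, Nat.floor_natCast]
      rcases Nat.eq_zero_or_pos n with rfl | hn0
      · exact Or.inl rfl
      · exact Or.inr ⟨⟨hn0, hn.1.le⟩, hn.2⟩
    calc ∑ n ∈ (Finset.range T).filter (fun n => ¬n.Prime), (Λ n : ℝ)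
        ≤ ∑ n ∈ insert 0 ((Finset.Ioc 0 ⌊(T : ℝ)⌋₊).filter (fun n => ¬n.Prime)), (Λ n : ℝ) :=
          Finset.sum_le_sum_of_subset_of_nonneg hsub fun _ _ _ =>
            ArithmeticFunction.vonMangoldt_nonneg
      _ = ∑ n ∈ (Finset.Ioc 0 ⌊(T : ℝ)⌋₊).filter (fun n => ¬n.Prime), (Λ n : ℝ) := by
          rw [Finset.sum_insert (by simp)]
          simp
      _ = Chebyshev.psi T - Chebyshev.theta T := (Chebyshev.psi_sub_theta_eq_sum_not_prime _).symm
      _ ≤ 2 * Real.sqrt T * Real.log T := Chebyshev.psi_sub_theta_le hT1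
  -- combine
  have hkey : ∑ p ∈ Nat.primesBelow T, χ p = ∑ n ∈ Finset.range T, w n • g n -
      ∑ n ∈ (Finset.range T).filter (fun n => ¬n.Prime), w n • g n := by
    rw [hsplit]; ring
  rw [hkey]
  calc _ ≤ ‖∑ n ∈ Finset.range T, w n • g n‖ +
        ‖∑ n ∈ (Finset.range T).filter (fun n => ¬n.Prime), w n • g n‖ := norm_sub_le _ _
    _ ≤ (Real.log 2)⁻¹ * M + 2 * Real.sqrt T * Real.log T / Real.log 2 := add_le_add hAbel hnp
    _ = M / Real.log 2 + 2 * Real.sqrt T * Real.log T / Real.log 2 := by ring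

/-! ### The Siegel–Walfisz bound for `ψ(·, χ)` and for `∑_{p<T} χ(p)` -/

/-- **Siegel–Walfisz for a non-principal character** (Davenport ch. 28; Cojocaru–Murty (9.31)):
under `SWBound A₂ C₂`, for `x ≥ 9`, `χ ≠ χ₀` mod `r` with `1 ≤ r ≤ (log x/2)^{A₂}`,
`max_{t ≤ x} ‖ψ(t, χ)‖ ≤ r (7√x + C₂ 2^{A₂} x/(log x)^{A₂})`
(`ψ(t, χ) = ∑_a χ(a)(ψ(t; r, a) − t/φ(r))`, `φ(r) ≤ r` classes, and the tree's
`abs_chebyshevPsiMod_sub_le_of_SW`). [cite: DavenportMNT1980, ch. 28] -/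
theorem chebyshevPsiCharSup_le_of_SW {A₂ C₂ : ℝ} (hA₂ : 0 < A₂) (hC₂ : 0 ≤ C₂)
    (hSW : SWBound A₂ C₂) {x : ℝ} (hx : 9 ≤ x) {r : ℕ} (hr : 1 ≤ r)
    (hrx : (r : ℝ) ≤ (Real.log x / 2) ^ A₂) {χ : DirichletCharacter ℂ r} (hχ : χ ≠ 1) :
    chebyshevPsiCharSup χ x ≤ r * (7 * Real.sqrt x + C₂ * 2 ^ A₂ * x / Real.log x ^ A₂) := by
  haveI : NeZero r := ⟨by omega⟩
  have hB : 0 ≤ 7 * Real.sqrt x + C₂ * 2 ^ A₂ * x / Real.log x ^ A₂ := by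
    have : 0 < Real.log x := Real.log_pos (by linarith)
    positivity
  refine chebyshevPsiCharSup_le χ (fun N hN => ?_) (by linarith)
  refine (norm_chebyshevPsiChar_le_sum_units hχ N).trans ?_
  calc ∑ a : (ZMod r)ˣ, |ParityWave0.chebyshevPsiMod r a N - N / Nat.totient r|
      ≤ ∑ _a : (ZMod r)ˣ, (7 * Real.sqrt x + C₂ * 2 ^ A₂ * x / Real.log x ^ A₂) :=
        Finset.sum_le_sum fun a _ =>
          abs_chebyshevPsiMod_sub_le_of_SW hA₂ hC₂ hSW hx hr hrx a (Nat.cast_nonneg N) hN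
    _ = (Nat.totient r : ℝ) * (7 * Real.sqrt x + C₂ * 2 ^ A₂ * x / Real.log x ^ A₂) := by
        rw [Finset.sum_const, Finset.card_univ, ZMod.card_units_eq_totient, nsmul_eq_mul]
    _ ≤ r * (7 * Real.sqrt x + C₂ * 2 ^ A₂ * x / Real.log x ^ A₂) := by
        gcongr
        exact_mod_cast Nat.totient_le r

/-- **`∑_{p<T} χ(p) ≪ r x/(log x)^B` from Siegel–Walfisz** (Nathanson, proof of Thm 10.7, p. 291):
under `SWBound A₂ C₂`, for `x ≥ 9`, `χ ≠ χ₀` mod `r`, `1 ≤ r ≤ (log x/2)^{A₂}`, and every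
`T ≤ x + 1`,
`‖∑_{p<T} χ(p)‖ ≤ r (7√x + C₂ 2^{A₂} x/(log x)^{A₂})/log 2 + 2√T log T/log 2`.
[cite: Nathanson1996, Thm 10.7 (proof, p. 291)] -/
theorem norm_sum_primesBelow_le_of_SW {A₂ C₂ : ℝ} (hA₂ : 0 < A₂) (hC₂ : 0 ≤ C₂)
    (hSW : SWBound A₂ C₂) {x : ℝ} (hx : 9 ≤ x) {r : ℕ} (hr : 1 ≤ r)
    (hrx : (r : ℝ) ≤ (Real.log x / 2) ^ A₂) {χ : DirichletCharacter ℂ r} (hχ : χ ≠ 1)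
    {T : ℕ} (hT : (T : ℝ) ≤ x + 1) :
    ‖∑ p ∈ Nat.primesBelow T, χ p‖ ≤
      r * (7 * Real.sqrt x + C₂ * 2 ^ A₂ * x / Real.log x ^ A₂) / Real.log 2 +
        2 * Real.sqrt T * Real.log T / Real.log 2 := by
  have hsup := chebyshevPsiCharSup_le_of_SW hA₂ hC₂ hSW hx hr hrx hχ
  refine norm_sum_primesBelow_le χ (fun k hk => ?_) ?_
  · refine (norm_chebyshevPsiChar_le_sup χ ?_).trans hsup
    have : (k : ℝ) + 1 ≤ T := by exact_mod_cast hk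
    linarith
  · exact (chebyshevPsiCharSup_nonneg χ x).trans hsup

end PrimeCharSum

end Literature.NumberTheory.Sieve
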